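import Summits.SmoothPoincare4.SmoothPoincare4.Theses.RicciFat
import Literature.Geometry.Riemannian.VolumeSphereTheoremGHDecomposition

/-!
# Birth skeleton for crux `RicciFat.VolumeSphereRecognition` (item stmt-SmoothPoincare4-5191)

Route `route-SmoothPoincare4-RicciFat`, crux rank 2 (skeleton registrar, 2026-08-17).

Crux (fixed, never restated): there is `δ > 0` such that every compact connected `C^∞`
4-manifold `M` (Hausdorff, second countable, modelled on `ℝ⁴`) with a `C^∞` Riemannian metric `h`
(Levi-Civita instance of the tree), `Ric_h ≥ 3h` and `Vol(M, h) = riemannianMeasure h univ ≥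
(1 − δ)·8π²/3` is `C^∞`-diffeomorphic to `S⁴ ⊂ ℝ⁵` — Cheeger–Colding 1997, Appendix 1, Thm A.1.10
at `n = 4` (the tree's named fact `Literature.Geometry.Riemannian.CheegerColding1997_thmA110`,
whose `.dim_four` is literally this crux; grounder g18-7, 2026-08-15).

## The line: the printed proof of Thm A.1.10 (p. 459), in dimension four

Cheeger–Colding prove A.1.10 in one sentence (JDG 46 (1997), p. 459): "By arguing as in [24], [25]
… but letting Theorem A.1.8 play the role of Perelman's theorem, we obtain the following
differentiable sphere theorem" — i.e. the theorem is the COMPOSITION of two theorems printed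
elsewhere, and these two theorems are the two stubs of this skeleton (they are exactly the `n = 4`
instances of the two children `Colding1996_volume_ghClose`, `CheegerColding1997_sphereStability`
into which the librarian split the named fact, `VolumeSphereTheoremGHDecomposition.lean`,
libsplit-27; the bridges `coldingVolumeShapeFour_of_fact` / `sphereStabilityFour_of_fact` below
PROVE that each stub is the `n = 4` instance of the corresponding tree fact, so a `_holds` for
either fact closes the stub in one line, and conversely a stub prover should land the general-`n`
fact in `Literature/Geometry/Riemannian/` and derive the stub):

* `stub_coldingVolumeShapeFour` — **Colding 1996, *Shape of manifolds with positive Ricci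
  curvature*, Invent. Math. 124, Main Theorem, `n = 4`**: for every `ε > 0` there is `δ > 0` such
  that a compact connected smooth Riemannian 4-manifold with `Ric ≥ 3` and
  `Vol ≥ (1 − δ)·8π²/3` admits an `ε`-Gromov–Hausdorff approximation to the unit ROUND `S⁴`
  (intrinsic great-circle distance `arccos ⟪x, y⟫` against Mathlib's length distance
  `Manifold.riemannianEDist` of `h`: the tree notion `IsRoundSphereGHApprox 4 h ε f`). Metric
  conclusion, no topology. Inputs in print: Bishop–Gromov, the segment inequality, Colding's
  `L²`-Toponogov / Cheeger–Colding almost rigidity [24], [25]. Size XL.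
* `stub_sphereStabilityFour` — **Cheeger–Colding 1997, Thm A.1.12 at `M⁴ = S⁴`, `ε`-form**: there
  is `ε > 0` such that a compact connected smooth Riemannian 4-manifold with `Ric ≥ −3` admitting an
  `ε`-Gromov–Hausdorff approximation to the unit round `S⁴` is diffeomorphic to `S⁴`. Metric
  hypothesis, no volume; curvature only bounded BELOW by `−3` (printed hypothesis (1.1)). Inputs in
  print: Colding's volume convergence (Thm A.1.5 = Colding 1997), relative volume comparison (1.2),
  "almost maximal volume ⟹ almost Euclidean ball" (Colding 1997 / [24]) giving the uniform
  Reifenberg condition at a small scale (Thms A.1.8–A.1.9), and the intrinsic Reifenberg theorem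
  Thms A.1.1–A.1.3 (bi-Hölder charts glued by centre of mass; the `ε`-isometry / near-orthonormal-
  frame / limit-map layers are begun in `VolumeSphereTheoremReifenbergProofs.lean`). Size XL.

`VolumeSphereRecognition_of` proves the crux BY NAME from the two stubs (choose `ε` from the
stability stub, `δ = δ(ε)` from Colding's stub; `Ric ≥ 3h ≥ −3h` because `h ≥ 0`); its own proof
term is `sorry`-free — the only `sorry`s of the file are the two stub bodies. (The audit
`#h21_check_skeleton` admits as hypotheses of the concluding theorem only NAMED obligations, so the
composition `stub₁-sig → stub₂-sig → crux` is realised as the body of `VolumeSphereRecognition_of`,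
exactly as in the registered exemplar `Cruxes/RicPosRecognition/Lines/birth.lean`.)

## Why two stubs and not more

The crux is a theorem in print whose proof is literally "Theorem 1 + Theorem 2"; the two stubs are
those theorems, each a major published result (neither is bookkeeping, neither restates the crux:
BC3 probes `stub → crux`, `stub → SmoothPoincare4` all fail, see `Lines/birth.md`). A finer cut of
the stability stub (GH-close + `Ric ≥ −3` ⟹ uniformly Reifenberg; Reifenberg + GH-close to `S⁴` ⟹
diffeomorphic, Thms A.1.8/A.1.3) needs a tree notion of `(ε, ρ)`-Reifenberg flatness of
`(M, d_h)` that does not exist yet; it is recorded in `Lines/birth.md` as the first glued split a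
stub prover may propose (`--supports stmt-SmoothPoincare4-5191`).

## Disproof.lean honoured / negatives

No `Disproof.lean` exists for this crux (`ledger crux ls stmt-SmoothPoincare4-5191`: no workfiles,
2026-08-17); `ledger negatives --problem SmoothPoincare4`: 0 refuted statements; no
`Theorems/VolumeSphereRecognition/Negative/`. Nothing to honour; no stub is an instance of a landed
Negative lemma (there are none).
-/

noncomputable section

-- the prescribed namespace `Summit.<P>.<Sub>.…` duplicates `SmoothPoincare4` (P = Sub)
set_option linter.dupNamespace false

open scoped Manifold ContDiff Topology ENNReal

namespace Summit.SmoothPoincare4.SmoothPoincare4.Cruxes.VolumeSphereRecognition.Birth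

/-! ## Stub A — Colding 1996 (Shape), Main Theorem, in dimension four -/

/-- **Stub A (Colding 1996, *Shape of manifolds with positive Ricci curvature*, Invent. Math. 124
(1996) 175–191, Main Theorem; `n = 4`).** Printed (Zbl 0871.53027): "Given an integer `n ≥ 2` and
`ε > 0`, there exists `δ = δ(n, ε) > 0` such that if `M` is an `n`-dimensional closed Riemannian
manifold with `Ric ≥ n − 1` and `Vol(M) ≥ Vol(Sⁿ) − δ`, then the Gromov–Hausdorff distance between
`M` and `Sⁿ` is at most `ε`." Here at `n = 4`, `Vol(S⁴) = 8π²/3`, volume threshold in the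
multiplicative form of the crux, and "`d_GH ≤ ε`" rendered as the existence of an
`ε`-Gromov–Hausdorff approximation `f : M → S⁴` to the unit ROUND sphere
(`Literature.Geometry.Riemannian.IsRoundSphereGHApprox`: distortion `≤ ε` of the great-circle
distance `arccos ⟪f a, f b⟫` against the length distance `Manifold.riemannianEDist` of `h`, and
`ε`-dense image). This is the `n = 4` instance of the tree's named fact
`Literature.Geometry.Riemannian.Colding1996_volume_ghClose` (PROVED below:
`coldingVolumeShapeFour_of_fact`). [cite: Colding1996Shape, Main Theorem; CheegerColding1997,
p. 459, ref. [24]] -/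
theorem stub_coldingVolumeShapeFour :
    ∀ ε : ℝ, 0 < ε → ∃ δ : ℝ, 0 < δ ∧
      ∀ (M : Type) [TopologicalSpace M] [T2Space M] [SecondCountableTopology M]
        [ChartedSpace (EuclideanSpace ℝ (Fin 4)) M] [IsManifold (𝓡 4) ∞ M] [CompactSpace M]
        [ConnectedSpace M] [MeasurableSpace M] [BorelSpace M]
        (h : Bundle.ContMDiffRiemannianMetric (𝓡 4) ∞ (EuclideanSpace ℝ (Fin 4))
          (TangentSpace (𝓡 4) : M → Type _))
        [(Literature.Geometry.Lorentzian.PseudoRiemannianMetric.ofRiemannian h).HasLeviCivita],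
        (∀ (x : M) (v : TangentSpace (𝓡 4) x), 3 * h.inner x v v ≤
            (Literature.Geometry.Lorentzian.PseudoRiemannianMetric.ofRiemannian h).ricci x v v) →
          ENNReal.ofReal ((1 - δ) * (8 * Real.pi ^ 2 / 3)) ≤
              Literature.Geometry.Lorentzian.riemannianMeasure h Set.univ →
            ∃ f : M → Metric.sphere (0 : EuclideanSpace ℝ (Fin 5)) 1,
              Literature.Geometry.Riemannian.IsRoundSphereGHApprox 4 h ε f := by
  sorry

/-! ## Stub B — Cheeger–Colding 1997, Thm A.1.12 at the round `S⁴`, `ε`-form -/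

/-- **Stub B (Cheeger–Colding 1997, Appendix 1, Thm A.1.12 at `M⁴ = S⁴`, `ε`-form; `n = 4`).**
Printed (JDG 46 (1997), p. 459): "Let the compact smooth Riemannian manifold, `Mⁿ`, be the
Gromov–Hausdorff limit of a sequence, `{M_iⁿ}`, satisfying (1.1) [`Ric_{M_iⁿ} ≥ −(n − 1)`]. Then
`M_iⁿ` is diffeomorphic to `Mⁿ`, for all `i` sufficiently large." At `Mⁿ = S⁴` the unit round
sphere and by contradiction along `εᵢ = 1/i`: there is `ε > 0` such that every compact connected
`C^∞` Riemannian 4-manifold `(M, h)` with `Ric_h ≥ −3h` admitting an `ε`-Gromov–Hausdorff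
approximation to the unit round `S⁴` (`IsRoundSphereGHApprox 4 h ε f`) is `C^∞`-diffeomorphic to
`S⁴ ⊂ ℝ⁵`. This is the theorem that "plays the role of Perelman's theorem" in the proof of
Thm A.1.10 (intrinsic Reifenberg method, Thms A.1.1–A.1.3, A.1.8–A.1.9, volume convergence A.1.5);
it is the `n = 4` instance of the tree's named fact
`Literature.Geometry.Riemannian.CheegerColding1997_sphereStability` (PROVED below:
`sphereStabilityFour_of_fact`). [cite: CheegerColding1997, Appendix 1 Thm A.1.12 (p. 459), at
Mⁿ = S⁴] -/
theorem stub_sphereStabilityFour :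
    ∃ ε : ℝ, 0 < ε ∧
      ∀ (M : Type) [TopologicalSpace M] [T2Space M] [SecondCountableTopology M]
        [ChartedSpace (EuclideanSpace ℝ (Fin 4)) M] [IsManifold (𝓡 4) ∞ M] [CompactSpace M]
        [ConnectedSpace M] [MeasurableSpace M] [BorelSpace M]
        (h : Bundle.ContMDiffRiemannianMetric (𝓡 4) ∞ (EuclideanSpace ℝ (Fin 4))
          (TangentSpace (𝓡 4) : M → Type _))
        [(Literature.Geometry.Lorentzian.PseudoRiemannianMetric.ofRiemannian h).HasLeviCivita],
        (∀ (x : M) (v : TangentSpace (𝓡 4) x), -3 * h.inner x v v ≤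
            (Literature.Geometry.Lorentzian.PseudoRiemannianMetric.ofRiemannian h).ricci x v v) →
          (∃ f : M → Metric.sphere (0 : EuclideanSpace ℝ (Fin 5)) 1,
              Literature.Geometry.Riemannian.IsRoundSphereGHApprox 4 h ε f) →
            Nonempty (M ≃ₘ⟮𝓡 4, 𝓡 4⟯ Metric.sphere (0 : EuclideanSpace ℝ (Fin 5)) 1) := by
  sorry

/-! ## The composition (kernel-checked; no `sorry` of its own) -/

/-- **The birth skeleton concludes the crux BY NAME** — the printed proof of Thm A.1.10 (p. 459) in
dimension four: take `ε > 0` from the sphere stability stub B, then `δ = δ(ε) > 0` from Colding's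
stub A; a compact connected `(M⁴, h)` with `Ric_h ≥ 3h` and `Vol ≥ (1 − δ)·8π²/3` is `ε`-GH-close to
the round `S⁴` (A) and `Ric_h ≥ 3h ≥ −3h` (`h ≥ 0`), hence diffeomorphic to `S⁴` (B).
[cite: CheegerColding1997, Appendix 1 Thm A.1.10 (p. 459), proof] -/
theorem VolumeSphereRecognition_of :
    Summit.SmoothPoincare4.SmoothPoincare4.Theses.RicciFat.VolumeSphereRecognition := by
  obtain ⟨ε, hε, HB⟩ := stub_sphereStabilityFour
  obtain ⟨δ, hδ, HA⟩ := stub_coldingVolumeShapeFour ε hε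
  refine ⟨δ, hδ, ?_⟩
  intro M _ _ _ _ _ _ _ _ _ h _ hRic hVol
  refine HB M h (fun x v => ?_) (HA M h hRic hVol)
  have h0 : 0 ≤ h.inner x v v := by
    by_cases hv : v = 0
    · subst hv
      simp
    · exact (h.pos x v hv).le
  have h1 := hRic x v
  linarith

/-! ## Bridges from the tree's named facts (PROVED): each stub is the `n = 4` instance -/

/-- Stub A is the `n = 4` instance of the named fact
`Literature.Geometry.Riemannian.Colding1996_volume_ghClose` (`(4 : ℝ) − 1 = 3`,
`|S⁴| = unitSphereVolume 4 = 8π²/3` by `unitSphereVolume_four`). So a proof of the Literature fact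
closes stub A in one line. [cite: Colding1996Shape, Main Theorem] -/
theorem coldingVolumeShapeFour_of_fact
    (H : Literature.Geometry.Riemannian.Colding1996_volume_ghClose) :
    ∀ ε : ℝ, 0 < ε → ∃ δ : ℝ, 0 < δ ∧
      ∀ (M : Type) [TopologicalSpace M] [T2Space M] [SecondCountableTopology M]
        [ChartedSpace (EuclideanSpace ℝ (Fin 4)) M] [IsManifold (𝓡 4) ∞ M] [CompactSpace M]
        [ConnectedSpace M] [MeasurableSpace M] [BorelSpace M]
        (h : Bundle.ContMDiffRiemannianMetric (𝓡 4) ∞ (EuclideanSpace ℝ (Fin 4))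
          (TangentSpace (𝓡 4) : M → Type _))
        [(Literature.Geometry.Lorentzian.PseudoRiemannianMetric.ofRiemannian h).HasLeviCivita],
        (∀ (x : M) (v : TangentSpace (𝓡 4) x), 3 * h.inner x v v ≤
            (Literature.Geometry.Lorentzian.PseudoRiemannianMetric.ofRiemannian h).ricci x v v) →
          ENNReal.ofReal ((1 - δ) * (8 * Real.pi ^ 2 / 3)) ≤
              Literature.Geometry.Lorentzian.riemannianMeasure h Set.univ →
            ∃ f : M → Metric.sphere (0 : EuclideanSpace ℝ (Fin 5)) 1,
              Literature.Geometry.Riemannian.IsRoundSphereGHApprox 4 h ε f := by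
  intro ε hε
  obtain ⟨δ, hδ, HA⟩ := H 4 (by norm_num) ε hε
  refine ⟨δ, hδ, ?_⟩
  intro M _ _ _ _ _ _ _ _ _ h _ hRic hVol
  refine HA M h (fun x v => ?_) ?_
  · have h3 : (((4 : ℕ) : ℝ) - 1) = 3 := by norm_num
    rw [h3]
    exact hRic x v
  · rw [Literature.Geometry.Riemannian.unitSphereVolume_four]
    exact hVol

/-- Stub B is the `n = 4` instance of the named fact
`Literature.Geometry.Riemannian.CheegerColding1997_sphereStability` (`−((4 : ℝ) − 1) = −3`). So a
proof of the Literature fact closes stub B in one line.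
[cite: CheegerColding1997, Appendix 1 Thm A.1.12 (p. 459)] -/
theorem sphereStabilityFour_of_fact
    (H : Literature.Geometry.Riemannian.CheegerColding1997_sphereStability) :
    ∃ ε : ℝ, 0 < ε ∧
      ∀ (M : Type) [TopologicalSpace M] [T2Space M] [SecondCountableTopology M]
        [ChartedSpace (EuclideanSpace ℝ (Fin 4)) M] [IsManifold (𝓡 4) ∞ M] [CompactSpace M]
        [ConnectedSpace M] [MeasurableSpace M] [BorelSpace M]
        (h : Bundle.ContMDiffRiemannianMetric (𝓡 4) ∞ (EuclideanSpace ℝ (Fin 4))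
          (TangentSpace (𝓡 4) : M → Type _))
        [(Literature.Geometry.Lorentzian.PseudoRiemannianMetric.ofRiemannian h).HasLeviCivita],
        (∀ (x : M) (v : TangentSpace (𝓡 4) x), -3 * h.inner x v v ≤
            (Literature.Geometry.Lorentzian.PseudoRiemannianMetric.ofRiemannian h).ricci x v v) →
          (∃ f : M → Metric.sphere (0 : EuclideanSpace ℝ (Fin 5)) 1,
              Literature.Geometry.Riemannian.IsRoundSphereGHApprox 4 h ε f) →
            Nonempty (M ≃ₘ⟮𝓡 4, 𝓡 4⟯ Metric.sphere (0 : EuclideanSpace ℝ (Fin 5)) 1) := by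
  obtain ⟨ε, hε, HB⟩ := H 4 (by norm_num)
  refine ⟨ε, hε, ?_⟩
  intro M _ _ _ _ _ _ _ _ _ h _ hRic hGH
  refine HB M h (fun x v => ?_) hGH
  have h3 : (-(((4 : ℕ) : ℝ) - 1)) = -3 := by norm_num
  rw [h3]
  exact hRic x v

end Summit.SmoothPoincare4.SmoothPoincare4.Cruxes.VolumeSphereRecognition.Birth

end
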